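import Summits.KontsevichZagierPeriods.KontsevichZagierPeriods.Theses.HodgeColevel
import Summits.KontsevichZagierPeriods.KontsevichZagierPeriods.Theorems.HodgeColevelCoresOfSummit
import Summits.KontsevichZagierPeriods.KontsevichZagierPeriods.Theorems.HodgeColevelDegreeCompressionStrength
import Summits.KontsevichZagierPeriods.KontsevichZagierPeriods.Theorems.MzvKernelInKZ.Negative.ScalingDivision
import Literature.NumberTheory.Transcendental.KZCalculusProofs
import Literature.NumberTheory.Transcendental.KZLogCalculusProofs
import Literature.NumberTheory.Transcendental.KZKernelConjectureForms

/-!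
# Route HodgeColevel — `SameDegreeConjecture` (stmt-KontsevichZagierPeriods-6178) is the summit too

Crux-strategist evidence for `DegreeCompression` (stmt-KontsevichZagierPeriods-6177, flagged
`summit_equivalent` by `DegreeCompressionStrength.degreeCompression_iff_kontsevichZagierPeriods`).
The route's deciding theorem is `closes : DegreeCompression → SameDegreeConjecture → KontsevichZagierPeriods`
and its own split of the summit is `S = DegreeCompression ∧ SameDegreeConjecture`
(`Target`, `CoresOfSummit`).  The first core was shown `≡ S` unconditionally (no sibling consumed).
Here the SECOND core collapses as well:

* `sameDegreeConjecture_iff_kontsevichZagierPeriods : SameDegreeConjecture ↔ KontsevichZagierPeriods`.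

So the split `S = DC ∧ SDC` is doubly degenerate (`S = S ∧ S`): neither core is a strictly weaker
piece, and the proved siblings in the cone of `closes` (`TargetOfCores`, `Assembly`, `CoresOfSummit`)
are glue resp. the converse direction.

## The argument (sign trick + torsion-freeness)

`SameDegreeConjecture` says: two representations of the SAME dimension `d`, both incompressible
(not KZ-equivalent to anything of dimension `< d`) and of equal value, are KZ-equivalent.  Take any
representation `s` of value `0` which is incompressible at its dimension `d` (any `d`, including `0`).
Its negative `s.neg = [σ, −f]` has the same dimension, the same value `0`, and is incompressible too
(`incompressible_neg`: `s.neg ~ t ⇒ s ~ t.neg`, because `[r] + [r.neg]` is an integrand-additivity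
relation, `KZ.of_add_of_mem_relations_of_eqOn_neg`).  Hence `SameDegreeConjecture` gives `s ~ s.neg`,
i.e. `[s] − [s.neg] ∈ relations`; adding `[s] + [s.neg] ∈ relations` gives `2 • [s] ∈ relations`, and
the formal period group is TORSION-FREE (`MzvKernelInKZ.Negative.mem_relations_of_nsmul_mem`:
division by a positive integer is a derived rule — scale the integrand by `1/2`), so `[s] ∈ relations`.
A strong induction on the dimension removes the incompressibility hypothesis (a compressible `s` is
equivalent to a lower-dimensional `t` of the same value `0`), giving ZERO FORM: every representation
of value `0` is null.  Zero form is zero access with the empty point as witness, which is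
`KZPeriodConjecture'` (`DegreeCompressionStrength.kzPeriodConjecture'_iff_zeroAccess`), which is the
summit (`kzPeriodConjecture'_iff_isRational`).  The converse is the proved sibling `coresOfSummit_proof`.

§4 records the same computation one level down for the auto-crux `SameDegreeOne`
(stmt-KontsevichZagierPeriods-6182): it already contains ZERO FORM IN DIMENSION ONE (every
`1`-dimensional representation of value `0` is null) — the kernel statement of the one-dimensional
period conjecture for arbitrary semialgebraic integrands, i.e. the Hermite–Lindemann/Baker sector
transferred into the move calculus (cf. route HodgeLevel's stratum items) — and the dimension-wise
split `SameDegreeOne ∧ SDC_{≥2} → KontsevichZagierPeriods` (dimension `0` is free), the best typed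
split with a proved assembly found by the strategist census of `DegreeCompression`.

Sources: M. Kontsevich, D. Zagier, *Periods* (2001), §1.1–1.2 (the moves; Conjecture 1; "no division
by integers" — here a derived rule); A. Huber, G. Wüstholz, *Transcendence and linear relations of
1-periods* (2022), Thm 13.3 (the dimension-one kernel statement).  Tree: `KZCalculus`,
`KZLogCalculusProofs` (`of_add_of_mem_relations_of_eqOn_neg`), `KZCalculusProofs` (`IntegralRep.empty`),
`Theorems/MzvKernelInKZ/Negative/ScalingDivision` (torsion-freeness),
`Theorems/HodgeColevelDegreeCompressionStrength` (zero access ⟺ summit; points of value `0` are null).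
-/

noncomputable section

open MeasureTheory Set
open Literature.NumberTheory.Transcendental
open Summit.KontsevichZagierPeriods.KontsevichZagierPeriods.Theses.HodgeColevel

namespace Summit.KontsevichZagierPeriods.HodgeColevel.SameDegreeStrength

variable {n m : ℕ}

/-! ## §1 The sign trick -/

/-- `[r] + [r.neg]` is a relation (integrand additivity with the zero integrand).
[Kontsevich–Zagier 2001, §1.2 rule (1)] [folklore] -/
theorem of_add_of_neg_mem_relations (r : KZ.IntegralRep n) :
    KZ.of r + KZ.of r.neg ∈ KZ.relations :=
  KZ.of_add_of_mem_relations_of_eqOn_neg (r := r) (r' := r.neg) rfl fun _ _ => rfl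

/-- Negation moves across an equivalence: `s.neg ~ t → s ~ t.neg`
(`[s] − [t.neg] = ([s] + [s.neg]) − ([s.neg] − [t]) − ([t] + [t.neg])`).
[Kontsevich–Zagier 2001, §1.2] [folklore] -/
theorem equivalent_neg_of_neg_equivalent {s : KZ.IntegralRep n} {t : KZ.IntegralRep m}
    (h : KZ.Equivalent s.neg t) : KZ.Equivalent s t.neg := by
  have e : KZ.of s - KZ.of t.neg =
      (KZ.of s + KZ.of s.neg) - (KZ.of s.neg - KZ.of t) - (KZ.of t + KZ.of t.neg) := by abel
  show KZ.of s - KZ.of t.neg ∈ KZ.relations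
  rw [e]
  exact KZ.relations.sub_mem (KZ.relations.sub_mem (of_add_of_neg_mem_relations s) h)
    (of_add_of_neg_mem_relations t)

/-- Incompressibility (no equivalent representation of dimension `< d`) passes to the negative.
[Kontsevich–Zagier 2001, §1.2] [folklore] -/
theorem incompressible_neg {d : ℕ} {s : KZ.IntegralRep d}
    (hinc : ∀ k < d, ∀ t : KZ.IntegralRep k, ¬ KZ.Equivalent s t) :
    ∀ k < d, ∀ t : KZ.IntegralRep k, ¬ KZ.Equivalent s.neg t :=
  fun k hk t ht => hinc k hk t.neg (equivalent_neg_of_neg_equivalent ht)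

/-! ## §2 From a same-degree hypothesis to zero form, dimension by dimension -/

/-- **Sign trick, one dimension at a time.** If the same-degree statement holds AT dimension `d`
(two incompressible `d`-dimensional representations of equal value are equivalent), then every
incompressible `d`-dimensional representation of value `0` is null: it is `2`-torsion (`s ~ s.neg`
plus `[s] + [s.neg] ∈ relations`) and the formal period group is torsion-free
(`MzvKernelInKZ.Negative.mem_relations_of_nsmul_mem`: division by `2` is a derived rule).
[Kontsevich–Zagier 2001, §1.2 Conjecture 1] [folklore] -/
theorem of_mem_relations_of_incompressible {d : ℕ}
    (hSd : ∀ r r' : KZ.IntegralRep d,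
      (∀ k < d, ∀ t : KZ.IntegralRep k, ¬ KZ.Equivalent r t) →
      (∀ k < d, ∀ t : KZ.IntegralRep k, ¬ KZ.Equivalent r' t) → r.value = r'.value → KZ.Equivalent r r')
    (s : KZ.IntegralRep d) (hinc : ∀ k < d, ∀ t : KZ.IntegralRep k, ¬ KZ.Equivalent s t)
    (hs0 : s.value = 0) : KZ.of s ∈ KZ.relations := by
  have h1 : KZ.Equivalent s s.neg :=
    hSd s s.neg hinc (incompressible_neg hinc) (by rw [KZ.IntegralRep.value_neg, hs0, neg_zero])
  have e : 2 • KZ.of s = (KZ.of s - KZ.of s.neg) + (KZ.of s + KZ.of s.neg) := by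
    rw [two_nsmul]; abel
  refine Summit.KontsevichZagierPeriods.MzvKernelInKZ.Negative.mem_relations_of_nsmul_mem two_pos ?_
  rw [e]
  exact KZ.relations.add_mem h1 (of_add_of_neg_mem_relations s)

/-- **Incompressible zero form ⇒ zero form**: if in every dimension the INCOMPRESSIBLE
representations of value `0` are null, then all representations of value `0` are null — strong
induction on the dimension (a compressible `s` is equivalent to a lower-dimensional `t`, of value `0`
by soundness `KZ.Equivalent.value_eq_holds`). [Kontsevich–Zagier 2001, §1.2] [folklore] -/
theorem zeroForm_of_incompressible
    (H : ∀ (d : ℕ) (s : KZ.IntegralRep d),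
      (∀ k < d, ∀ t : KZ.IntegralRep k, ¬ KZ.Equivalent s t) → s.value = 0 → KZ.of s ∈ KZ.relations) :
    ∀ (d : ℕ) (s : KZ.IntegralRep d), s.value = 0 → KZ.of s ∈ KZ.relations := by
  intro d
  induction d using Nat.strong_induction_on with
  | _ d ih =>
    intro s hs0
    by_cases hc : ∃ k < d, ∃ t : KZ.IntegralRep k, KZ.Equivalent s t
    · obtain ⟨k, hk, t, ht⟩ := hc
      have ht0 : t.value = 0 := (KZ.Equivalent.value_eq_holds ht).symm.trans hs0
      have e : KZ.of s = (KZ.of s - KZ.of t) + KZ.of t := by abel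
      rw [e]
      exact KZ.relations.add_mem ht (ih k hk t ht0)
    · push Not at hc
      exact H d s hc hs0

/-- **Zero form ⇒ the summit**: zero form is zero access (empty point as witness,
`KZ.IntegralRep.of_empty_mem_relations`), zero access is `KZPeriodConjecture'`
(`DegreeCompressionStrength.kzPeriodConjecture'_iff_zeroAccess`), and that is the summit
(`kzPeriodConjecture'_iff_isRational`). [Kontsevich–Zagier 2001, §1.2 Conjecture 1] [folklore] -/
theorem kontsevichZagierPeriods_of_zeroForm
    (hZ : ∀ (d : ℕ) (s : KZ.IntegralRep d), s.value = 0 → KZ.of s ∈ KZ.relations) :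
    KontsevichZagierPeriods :=
  kzPeriodConjecture'_iff_isRational.mp <|
    DegreeCompressionStrength.kzPeriodConjecture'_iff_zeroAccess.mpr fun N R hR0 =>
      ⟨KZ.IntegralRep.empty 0,
        KZ.relations.sub_mem (hZ N R hR0) KZ.IntegralRep.of_empty_mem_relations⟩

/-! ## §3 `SameDegreeConjecture` is the summit -/

/-- **`SameDegreeConjecture → KontsevichZagierPeriods`** (sign trick in every dimension, torsion,
strong induction, zero access). [Kontsevich–Zagier 2001, §1.2 Conjecture 1] [folklore] -/
theorem kontsevichZagierPeriods_of_sameDegreeConjecture (hS : SameDegreeConjecture) :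
    KontsevichZagierPeriods :=
  kontsevichZagierPeriods_of_zeroForm <|
    zeroForm_of_incompressible fun d s hinc hs0 => of_mem_relations_of_incompressible (hS d) s hinc hs0

/-- **`SameDegreeConjecture ↔ KontsevichZagierPeriods`** — the route's second core is the summit
(converse: the proved sibling `coresOfSummit_proof`). [Kontsevich–Zagier 2001, §1.2 Conjecture 1] [folklore] -/
theorem sameDegreeConjecture_iff_kontsevichZagierPeriods :
    SameDegreeConjecture ↔ KontsevichZagierPeriods :=
  ⟨kontsevichZagierPeriods_of_sameDegreeConjecture, fun h => (coresOfSummit_proof h).2⟩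

/-- Hence the two cores of the route are equivalent to EACH OTHER: the split `S = DC ∧ SDC` of
`Target` / `CoresOfSummit` is `S = S ∧ S`. [folklore] -/
theorem sameDegreeConjecture_iff_degreeCompression : SameDegreeConjecture ↔ DegreeCompression :=
  sameDegreeConjecture_iff_kontsevichZagierPeriods.trans
    DegreeCompressionStrength.degreeCompression_iff_kontsevichZagierPeriods.symm

/-- And `SameDegreeConjecture` alone already proves the route's `Target`. [folklore] -/
theorem target_of_sameDegreeConjecture (hS : SameDegreeConjecture) : Target :=
  ⟨sameDegreeConjecture_iff_degreeCompression.mp hS, hS⟩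

/-! ## §4 One level down: `SameDegreeOne`, and the dimension-wise split of the summit -/

/-- `SameDegreeOne` is the same-degree hypothesis at dimension `1` (its incompressibility clauses
quantify over points only). [folklore] -/
theorem sameDegreeAt_one_of_sameDegreeOne (h1 : SameDegreeOne) :
    ∀ r r' : KZ.IntegralRep 1,
      (∀ k < 1, ∀ t : KZ.IntegralRep k, ¬ KZ.Equivalent r t) →
      (∀ k < 1, ∀ t : KZ.IntegralRep k, ¬ KZ.Equivalent r' t) → r.value = r'.value → KZ.Equivalent r r' :=
  fun r r' hr hr' hv => h1 r r' (hr 0 one_pos) (hr' 0 one_pos) hv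

/-- **`SameDegreeOne` ⟹ zero form in dimension `1`**: every `1`-dimensional representation of value
`0` is null.  A compressible one is equivalent to a point of value `0`, which is null
(`DegreeCompressionStrength.of_mem_relations_of_dimZero`); an incompressible one is `2`-torsion by the
sign trick at `d = 1`.  (This is the kernel form of the one-dimensional period conjecture for
arbitrary semialgebraic integrands on semialgebraic subsets of `ℝ` — the Hermite–Lindemann/Baker
sector transferred into the move calculus, cf. Huber–Wüstholz 2022, Thm 13.3 — so the rank-9
"first rung" already carries that content.) [Kontsevich–Zagier 2001, §1.2 Conjecture 1] [folklore] -/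
theorem of_mem_relations_of_dim_one (h1 : SameDegreeOne) (s : KZ.IntegralRep 1) (hs0 : s.value = 0) :
    KZ.of s ∈ KZ.relations := by
  by_cases hc : ∃ t : KZ.IntegralRep 0, KZ.Equivalent s t
  · obtain ⟨t, ht⟩ := hc
    have ht0 : t.value = 0 := (KZ.Equivalent.value_eq_holds ht).symm.trans hs0
    have e : KZ.of s = (KZ.of s - KZ.of t) + KZ.of t := by abel
    rw [e]
    exact KZ.relations.add_mem ht (DegreeCompressionStrength.of_mem_relations_of_dimZero t ht0)
  · push Not at hc
    refine of_mem_relations_of_incompressible (sameDegreeAt_one_of_sameDegreeOne h1) s ?_ hs0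
    intro k hk t
    obtain rfl : k = 0 := Nat.lt_one_iff.mp hk
    exact hc t

/-- **The dimension-wise split of the summit through the route's own vocabulary**:
`SameDegreeOne` (dimension `1`) together with the same-degree statement in dimensions `≥ 2` already
gives `KontsevichZagierPeriods` — dimension `0` is free (`of_mem_relations_of_dimZero`).  So
`SameDegreeConjecture = SDC₀ ∧ SameDegreeOne ∧ SDC_{≥2}` with `SDC₀` a theorem; recorded for the
crux-strategist census of `DegreeCompression` (`≡ SameDegreeConjecture`) as the best TYPED split with a
proved assembly, whose top piece is nevertheless summit-strength modulo the existence of one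
incompressible representation of dimension `≥ 2` (see `Cruxes/DegreeCompression/STRATEGY-CENSUS.md`).
[Kontsevich–Zagier 2001, §1.2 Conjecture 1] [folklore] -/
theorem kontsevichZagierPeriods_of_sameDegreeOne_of_twoUp (h1 : SameDegreeOne)
    (h2 : ∀ d : ℕ, 2 ≤ d → ∀ r r' : KZ.IntegralRep d,
      (∀ k < d, ∀ t : KZ.IntegralRep k, ¬ KZ.Equivalent r t) →
      (∀ k < d, ∀ t : KZ.IntegralRep k, ¬ KZ.Equivalent r' t) → r.value = r'.value → KZ.Equivalent r r') :
    KontsevichZagierPeriods := by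
  refine kontsevichZagierPeriods_of_zeroForm (zeroForm_of_incompressible fun d s hinc hs0 => ?_)
  rcases Nat.lt_or_ge d 2 with hd | hd
  · interval_cases d
    · exact DegreeCompressionStrength.of_mem_relations_of_dimZero s hs0
    · exact of_mem_relations_of_dim_one h1 s hs0
  · exact of_mem_relations_of_incompressible (h2 d hd) s hinc hs0

end Summit.KontsevichZagierPeriods.HodgeColevel.SameDegreeStrength

end
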